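import Mathlib.Tactic.Linarith
import Summits.CriticalPhenomena.PercolationContinuityZ3.Theorems.PercNearOneGluingNoHeavyLowerTailSahiCTCCoLevelOne
import Summits.CriticalPhenomena.PercolationContinuityZ3.Theorems.PercNearOneGluingNoHeavyLowerTailSahiCTCHarrisUp
import HarnessLib

/-!
# `NoHeavyLowerTail` (crux stmt-CriticalPhenomena-4575), P3 lane: COMPLEMENT DUALITY AT THE CO-LEVEL —
# `coeff_{4·𝟙−n} Ñ_{|V|−1}(coFam 𝒳, coFam 𝒵) = coeff_n M₁(𝒳,𝒵)`, hence `Ñ_{|V|−1}(coFam 𝒳, coFam 𝒵) ∈ ℕ[r]` for all up-sets, and row (a) at the co-level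

Support file (seat `prim-l12-p3`, gen 24; `--supports stmt-CriticalPhenomena-4575`).  Memo
`run/shared/lean/prim/prim-l12/FROM-prim-l12-p3-g24-VALUE-LEVEL-TH2K.md` §3 (Lean plan item (5)).  Companions: `…SahiCTCCoLevelOne`
(`M₁(𝒳,𝒵) ∈ ℕ[s]`), `…SahiCTCHarrisUp` (`coFam`, `rev2`, the two-factor reversal), `…SahiCTCNcGen` (`Ngen`).

The member-complement map `S ↦ V ∖ S` (`coFam`) identifies a complex `K_𝒳` (closed sets) with the up-set `𝒳` of open sets and sends the
level-`(|V|−1)` dictionary of `…SahiCTCNcGen` to the co-level-1 dictionary of `…SahiCTCLoopSplit`: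
`h ↦ 𝒳∖{∅}`, `t ↦ 𝒳∩{∅}`, `h_Y ↦ (𝒳∩𝒵)∖{∅}`, `e_Y ↦` common singletons, `Θ_{|V|−1} ↦ 2^V∖{∅}`, `D_{|V|−1} ↦ {∅}`, `e_{|V|−1} ↦ e₁`
(`facesLE_coFam`, …, `ee_colevel_eq`).  Every monomial of `Ñ_c` is a product of FOUR generating functions, and member-complementation reverses
the profile of such a product (`coeff_rev4_prod4`: `n ↦ 4·𝟙 − n`, from the two-factor reversal), so
* `coeff_Ngen_colevel_rev4` : `coeff_{4𝟙−n}(Ñ_{|V|−1}(coFam 𝒳, coFam 𝒵)) = coeff_n(M₁(𝒳,𝒵))` (`n ≤ 4`), `coeff_Ngen_colevel_eq_zero` (other profiles);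
* **`coeff_Ngen_colevel_coFam_nonneg`** : `Ñ_{|V|−1}(coFam 𝒳, coFam 𝒵) ∈ ℕ[r]` for all up-sets `𝒳, 𝒵` of a nonempty finite type (from `coeff_M1_nonneg`);
* **`coeff_aPoly_colevel_one_nonneg`** : row (a) at the co-level, `(Π + D_{|V|−1})·e_{|V|−1} − Θ_{|V|−1}·D_{|V|−1} ∈ ℕ[r]` (the pair `(R,V)` of `Π·D`
  is paid by `(R ∪ {x}, V ∖ {x})` of `Π·e`, or by `(V,V)` of `D²`).
The endpoint on the pattern cube (`cx 𝒳 = coFam(open sets)`, the certificate `ρ_{k−1}` and Kahn C5 / Sahi C₃ for "at least one of `k` open")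
is the companion `…SahiAtLeastOneCert`.  Nothing is asserted about the crux.
-/

namespace Summit.CriticalPhenomena.PercolationContinuityZ3.Theorems.SahiCTCForms

open Finset MvPolynomial SahiCTCGenFun

variable {α : Type*} [DecidableEq α] [Fintype α]

/-! ### Four-fold profile reversal -/

/-- The reversed profile `4·𝟙 − n` (for the four-factor forms). [this work] -/
noncomputable def rev4 (n : α →₀ ℕ) : α →₀ ℕ := 4 • ind (univ : Finset α) - n

/-- `(4·𝟙 − n) i = 4 − n i`. [this work] -/
theorem rev4_apply (n : α →₀ ℕ) (i : α) : rev4 n i = 4 - n i := by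
  unfold rev4
  rw [Finsupp.tsub_apply, Finsupp.smul_apply, ind_apply, if_pos (mem_univ i)]
  simp

/-- `rev2` is an involution on the profiles `≤ 2`. [this work] -/
theorem rev2_rev2 {a : α →₀ ℕ} (ha : ∀ i, a i ≤ 2) : rev2 (rev2 a) = a := by
  ext i; rw [rev2_apply, rev2_apply]; have := ha i; omega

/-- `rev2 a ≤ 2` pointwise. [this work] -/
theorem rev2_le_two (a : α →₀ ℕ) : ∀ i, rev2 a i ≤ 2 := fun i => by rw [rev2_apply]; omega

/-- `rev4` is an involution on the profiles `≤ 4`. [this work] -/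
theorem rev4_rev4 {a : α →₀ ℕ} (ha : ∀ i, a i ≤ 4) : rev4 (rev4 a) = a := by
  ext i; rw [rev4_apply, rev4_apply]; have := ha i; omega

/-- `rev4 a ≤ 4` pointwise. [this work] -/
theorem rev4_le_four (a : α →₀ ℕ) : ∀ i, rev4 a i ≤ 4 := fun i => by rw [rev4_apply]; omega

omit [Fintype α] in
/-- A product of two generating functions has no coefficient at a profile with an entry `> 2`. [this work] -/
theorem coeff_gf_mul_gf_eq_zero (A B : Finset (Finset α)) {a : α →₀ ℕ} (ha : ¬ ∀ i, a i ≤ 2) : (gf A * gf B).coeff a = 0 := by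
  rw [coeff_gf_mul_gf, filter_prod_eq_empty _ _ a ha, card_empty]; rfl

/-- On profiles `≤ 2`: `a + b = 4·𝟙 − n ↔ rev2 a + rev2 b = n` (`n ≤ 4`). [this work] -/
theorem add_eq_rev4_iff {n a b : α →₀ ℕ} (hn : ∀ i, n i ≤ 4) (ha : ∀ i, a i ≤ 2) (hb : ∀ i, b i ≤ 2) :
    a + b = rev4 n ↔ rev2 a + rev2 b = n := by
  constructor
  · intro h; ext i
    have hi := DFunLike.congr_fun h i
    rw [Finsupp.add_apply, rev4_apply] at hi
    rw [Finsupp.add_apply, rev2_apply, rev2_apply]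
    have := hn i; have := ha i; have := hb i; omega
  · intro h; ext i
    have hi := DFunLike.congr_fun h i
    rw [Finsupp.add_apply, rev2_apply, rev2_apply] at hi
    rw [Finsupp.add_apply, rev4_apply]
    have := hn i; have := ha i; have := hb i; omega

/-- **Four-fold reversal**: for families `A, B, C, D` and a profile `n ≤ 4`,
`coeff_{4𝟙−n}((GF Ā·GF B̄)·(GF C̄·GF D̄)) = coeff_n((GF A·GF B)·(GF C·GF D))`. [this work] -/
theorem coeff_rev4_prod4 (A B C D : Finset (Finset α)) {n : α →₀ ℕ} (hn : ∀ i, n i ≤ 4) :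
    ((gf (coFam A) * gf (coFam B)) * (gf (coFam C) * gf (coFam D))).coeff (rev4 n) =
      ((gf A * gf B) * (gf C * gf D)).coeff n := by
  rw [coeff_mul, coeff_mul]
  -- drop the vanishing terms on both sides
  have hL : ∑ x ∈ HasAntidiagonal.antidiagonal (rev4 n), (gf (coFam A) * gf (coFam B)).coeff x.1 * (gf (coFam C) * gf (coFam D)).coeff x.2 =
      ∑ x ∈ (HasAntidiagonal.antidiagonal (rev4 n)).filter (fun x => (∀ i, x.1 i ≤ 2) ∧ (∀ i, x.2 i ≤ 2)),
        (gf (coFam A) * gf (coFam B)).coeff x.1 * (gf (coFam C) * gf (coFam D)).coeff x.2 := by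
    rw [sum_filter]
    refine sum_congr rfl fun x _ => ?_
    split_ifs with h
    · rfl
    · rcases not_and_or.1 h with h1 | h2
      · rw [coeff_gf_mul_gf_eq_zero _ _ h1, zero_mul]
      · rw [coeff_gf_mul_gf_eq_zero _ _ h2, mul_zero]
  have hR : ∑ x ∈ HasAntidiagonal.antidiagonal n, (gf A * gf B).coeff x.1 * (gf C * gf D).coeff x.2 =
      ∑ x ∈ (HasAntidiagonal.antidiagonal n).filter (fun x => (∀ i, x.1 i ≤ 2) ∧ (∀ i, x.2 i ≤ 2)),
        (gf A * gf B).coeff x.1 * (gf C * gf D).coeff x.2 := by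
    rw [sum_filter]
    refine sum_congr rfl fun x _ => ?_
    split_ifs with h
    · rfl
    · rcases not_and_or.1 h with h1 | h2
      · rw [coeff_gf_mul_gf_eq_zero _ _ h1, zero_mul]
      · rw [coeff_gf_mul_gf_eq_zero _ _ h2, mul_zero]
  rw [hL, hR]
  refine sum_nbij' (fun x => (rev2 x.1, rev2 x.2)) (fun x => (rev2 x.1, rev2 x.2)) (fun x hx => ?_) (fun x hx => ?_)
    (fun x hx => ?_) (fun x hx => ?_) (fun x hx => ?_)
  · obtain ⟨hx, h1, h2⟩ := mem_filter.1 hx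
    rw [HasAntidiagonal.mem_antidiagonal] at hx
    exact mem_filter.2 ⟨HasAntidiagonal.mem_antidiagonal.2 ((add_eq_rev4_iff hn h1 h2).1 hx), rev2_le_two _, rev2_le_two _⟩
  · obtain ⟨hx, h1, h2⟩ := mem_filter.1 hx
    rw [HasAntidiagonal.mem_antidiagonal] at hx
    refine mem_filter.2 ⟨HasAntidiagonal.mem_antidiagonal.2 ?_, rev2_le_two _, rev2_le_two _⟩
    rw [add_eq_rev4_iff hn (rev2_le_two _) (rev2_le_two _), rev2_rev2 h1, rev2_rev2 h2]; exact hx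
  · obtain ⟨_, h1, h2⟩ := mem_filter.1 hx
    simp only [rev2_rev2 h1, rev2_rev2 h2]
  · obtain ⟨_, h1, h2⟩ := mem_filter.1 hx
    simp only [rev2_rev2 h1, rev2_rev2 h2]
  · obtain ⟨_, h1, h2⟩ := mem_filter.1 hx
    have e1 := coeff_gf_mul_gf_coFam A B (rev2_le_two x.1)
    have e2 := coeff_gf_mul_gf_coFam C D (rev2_le_two x.2)
    rw [rev2_rev2 h1] at e1; rw [rev2_rev2 h2] at e2
    rw [e1, e2]

/-- A four-fold product of generating functions has no coefficient at a profile with an entry `> 4`. [this work] -/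
theorem coeff_prod4_eq_zero (A B C D : Finset (Finset α)) {m : α →₀ ℕ} (hm : ¬ ∀ i, m i ≤ 4) :
    ((gf A * gf B) * (gf C * gf D)).coeff m = 0 := by
  rw [coeff_mul]
  refine sum_eq_zero fun x hx => ?_
  rw [HasAntidiagonal.mem_antidiagonal] at hx
  by_cases h1 : ∀ i, x.1 i ≤ 2
  · by_cases h2 : ∀ i, x.2 i ≤ 2
    · exfalso; apply hm; intro i
      have := DFunLike.congr_fun hx i
      rw [Finsupp.add_apply] at this
      have := h1 i; have := h2 i; omega
    · rw [coeff_gf_mul_gf_eq_zero _ _ h2, mul_zero]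
  · rw [coeff_gf_mul_gf_eq_zero _ _ h1, zero_mul]

/-! ### The co-level-1 dictionary: closed families of `coFam F` at level `|V| − 1` are member-complements of open families -/

section Dict

variable (hV : 0 < Fintype.card α)
include hV

omit [DecidableEq α] in
/-- `#S ≤ |V| − 1 ↔ S ≠ V` (nonempty type). [this work] -/
theorem card_le_pred_iff_ne_univ [DecidableEq α] (S : Finset α) : #S ≤ Fintype.card α - 1 ↔ S ≠ univ := by
  rw [← card_lt_iff_ne_univ]; omega

/-- `V ∖ S = ∅ ↔ S = V`. [this work] -/
theorem univ_sdiff_eq_empty_iff (S : Finset α) : (univ : Finset α) \ S = ∅ ↔ S = univ := by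
  have _ := hV
  rw [sdiff_eq_empty_iff_subset]; exact ⟨fun h => univ_subset_iff.1 h, fun h => h ▸ Subset.rfl⟩

/-- `h` at level `|V|−1`: `facesLE (|V|−1) (coFam F) = coFam (F ∖ {∅})`. [this work] -/
theorem facesLE_coFam (F : Finset (Finset α)) : facesLE (Fintype.card α - 1) (coFam F) = coFam (F.erase ∅) := by
  ext S
  simp only [facesLE, mem_filter, mem_powerset, subset_univ, true_and, mem_coFam, mem_erase, card_le_pred_iff_ne_univ hV, ne_eq,
    univ_sdiff_eq_empty_iff hV]

/-- `t` at level `|V|−1`: `facesGT (|V|−1) (coFam F) = coFam (F ∩ {∅})`. [this work] -/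
theorem facesGT_coFam (F : Finset (Finset α)) : facesGT (Fintype.card α - 1) (coFam F) = coFam (empPart F) := by
  ext S
  simp only [facesGT, empPart, mem_filter, mem_powerset, subset_univ, true_and, mem_coFam, univ_sdiff_eq_empty_iff hV]
  have : Fintype.card α - 1 < #S ↔ S = univ := by
    rw [← not_iff_not, not_lt, card_le_pred_iff_ne_univ hV]
  rw [this]; tauto

/-- `h_Y` at level `|V|−1`. [this work] -/
theorem commonLE_coFam (F G : Finset (Finset α)) :
    commonLE (Fintype.card α - 1) (coFam F) (coFam G) = coFam ((F ∩ G).erase ∅) := by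
  ext S
  simp only [commonLE, mem_filter, mem_powerset, subset_univ, true_and, mem_coFam, mem_erase, mem_inter,
    card_le_pred_iff_ne_univ hV, ne_eq, univ_sdiff_eq_empty_iff hV]

/-- `#S = |V| − 1 ↔ V ∖ S` is a singleton. [this work] -/
theorem card_eq_pred_iff (S : Finset α) : #S = Fintype.card α - 1 ↔ ∃ u, (univ : Finset α) \ S = {u} := by
  rw [← card_eq_one, card_univ_sdiff]
  have := card_le_univ S
  omega

/-- `e_Y` at level `|V|−1`: the common co-singletons are the member-complements of the common singletons. [this work] -/
theorem commonEQ_coFam (F G : Finset (Finset α)) :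
    commonEQ (Fintype.card α - 1) (coFam F) (coFam G) = coFam (singles (loops F G)) := by
  ext S
  simp only [commonEQ, mem_filter, mem_powerset, subset_univ, true_and, mem_coFam, mem_singles, loops, mem_univ, card_eq_pred_iff hV]
  constructor
  · rintro ⟨⟨u, hu⟩, hF, hG⟩
    exact ⟨u, ⟨by rw [← hu]; exact hF, by rw [← hu]; exact hG⟩, hu⟩
  · rintro ⟨u, ⟨hF, hG⟩, hu⟩
    exact ⟨⟨u, hu⟩, by rw [hu]; exact hF, by rw [hu]; exact hG⟩

/-- `Θ_{|V|−1} = GF(coFam (2^V ∖ {∅}))`. [this work] -/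
theorem ThC_colevel_eq : (ThC (Fintype.card α - 1) : MvPolynomial α ℤ) = gf (coFam ((univ.powerset : Finset (Finset α)).erase ∅)) := by
  unfold ThC bySize; congr 1; ext S
  simp only [mem_filter, mem_powerset, subset_univ, true_and, mem_coFam, mem_erase, card_le_pred_iff_ne_univ hV, ne_eq,
    univ_sdiff_eq_empty_iff hV, and_true]

/-- `D_{|V|−1} = GF(coFam {∅})` (`= GF{V}`). [this work] -/
theorem DdC_colevel_eq : (DdC (Fintype.card α - 1) : MvPolynomial α ℤ) = gf (coFam ({∅} : Finset (Finset α))) := by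
  unfold DdC bySize; congr 1; ext S
  simp only [mem_filter, mem_powerset, subset_univ, true_and, mem_coFam, mem_singleton, univ_sdiff_eq_empty_iff hV]
  rw [← not_iff_not, not_lt, card_le_pred_iff_ne_univ hV]

/-- `e_{|V|−1} = GF(coFam e₁)`. [this work] -/
theorem ee_colevel_eq : (ee (Fintype.card α - 1) : MvPolynomial α ℤ) = gf (coFam (bySize (· = 1) : Finset (Finset α))) := by
  unfold ee bySize; congr 1; ext S
  simp only [mem_filter, mem_powerset, subset_univ, true_and, mem_coFam, card_eq_pred_iff hV, card_eq_one]

end Dict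

/-! ### `Ñ_{|V|−1}(coFam F, coFam G)` and `M₁(F,G)` are reversals of each other -/

/-- `Π = GF(coFam 2^V)`. [this work] -/
theorem PiP_eq_gf_coFam : (PiP : MvPolynomial α ℤ) = gf (coFam (univ.powerset : Finset (Finset α))) := by
  unfold PiP; rw [coFam_univ_powerset]

omit [DecidableEq α] in
/-- `e₁ = GF(sets of size 1)` (definitional restatement). [this work] -/
theorem ee_one_eq : (ee 1 : MvPolynomial α ℤ) = gf (bySize (· = 1) : Finset (Finset α)) := rfl

/-- `Ñ_{|V|−1}` of a pair of member-complemented families as a signed sum of eight four-fold products of member-complemented generating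
functions. [this work] -/
theorem Ngen_colevel_eq (hV : 0 < Fintype.card α) (F G : Finset (Finset α)) :
    Ngen (Fintype.card α - 1) (coFam F) (coFam G) =
      (gf (coFam (bySize (· = 1))) * gf (coFam univ.powerset)) * (gf (coFam univ.powerset) * gf (coFam ((F ∩ G).erase ∅)))
      - (gf (coFam (bySize (· = 1))) * gf (coFam univ.powerset)) * (gf (coFam (F.erase ∅)) * gf (coFam (G.erase ∅)))
      + (gf (coFam (bySize (· = 1))) * gf (coFam {∅})) * (gf (coFam univ.powerset) * gf (coFam ((F ∩ G).erase ∅)))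
      - (gf (coFam (bySize (· = 1))) * gf (coFam {∅})) * (gf (coFam (F.erase ∅)) * gf (coFam (G.erase ∅)))
      - (gf (coFam (univ.powerset.erase ∅)) * gf (coFam univ.powerset)) * (gf (coFam {∅}) * gf (coFam (singles (loops F G))))
      - (gf (coFam (bySize (· = 1))) * gf (coFam {∅})) * (gf (coFam (F.erase ∅)) * gf (coFam (empPart G)))
      - (gf (coFam (bySize (· = 1))) * gf (coFam {∅})) * (gf (coFam (empPart F)) * gf (coFam (G.erase ∅)))
      + (gf (coFam (bySize (· = 1))) * gf (coFam (univ.powerset.erase ∅))) * (gf (coFam (empPart F)) * gf (coFam (empPart G))) := by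
  unfold Ngen
  rw [facesLE_coFam hV, facesLE_coFam hV, facesGT_coFam hV, facesGT_coFam hV, commonLE_coFam hV, commonEQ_coFam hV, ThC_colevel_eq hV,
    DdC_colevel_eq hV, ee_colevel_eq hV, PiP_eq_gf_coFam]
  ring

/-- `M₁` as the same signed sum with the open families. [this work] -/
theorem M1_eq_prod4 (F G : Finset (Finset α)) :
    M1 F G =
      (gf (bySize (· = 1)) * gf univ.powerset) * (gf univ.powerset * gf ((F ∩ G).erase ∅))
      - (gf (bySize (· = 1)) * gf univ.powerset) * (gf (F.erase ∅) * gf (G.erase ∅))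
      + (gf (bySize (· = 1)) * gf {∅}) * (gf univ.powerset * gf ((F ∩ G).erase ∅))
      - (gf (bySize (· = 1)) * gf {∅}) * (gf (F.erase ∅) * gf (G.erase ∅))
      - (gf (univ.powerset.erase ∅) * gf univ.powerset) * (gf {∅} * gf (singles (loops F G)))
      - (gf (bySize (· = 1)) * gf {∅}) * (gf (F.erase ∅) * gf (empPart G))
      - (gf (bySize (· = 1)) * gf {∅}) * (gf (empPart F) * gf (G.erase ∅))
      + (gf (bySize (· = 1)) * gf (univ.powerset.erase ∅)) * (gf (empPart F) * gf (empPart G)) := by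
  have hE : gf ((univ.powerset : Finset (Finset α)).erase ∅) = PiP - 1 := by rw [PiP_eq_gf_erase_add_one (α := α)]; ring
  rw [gf_singleton_empty, hE]
  unfold M1 ee PiP
  ring

/-- **Reversal**: for `n ≤ 4`, `coeff_{4𝟙−n}(Ñ_{|V|−1}(coFam F, coFam G)) = coeff_n(M₁(F,G))`. [this work] -/
theorem coeff_Ngen_colevel_rev4 (hV : 0 < Fintype.card α) (F G : Finset (Finset α)) {n : α →₀ ℕ} (hn : ∀ i, n i ≤ 4) :
    (Ngen (Fintype.card α - 1) (coFam F) (coFam G)).coeff (rev4 n) = (M1 F G).coeff n := by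
  rw [Ngen_colevel_eq hV, M1_eq_prod4]
  simp only [coeff_add, coeff_sub, coeff_rev4_prod4 _ _ _ _ hn]

/-- At a profile with an entry `> 4`, `Ñ_{|V|−1}(coFam F, coFam G)` has coefficient `0`. [this work] -/
theorem coeff_Ngen_colevel_eq_zero (hV : 0 < Fintype.card α) (F G : Finset (Finset α)) {m : α →₀ ℕ} (hm : ¬ ∀ i, m i ≤ 4) :
    (Ngen (Fintype.card α - 1) (coFam F) (coFam G)).coeff m = 0 := by
  rw [Ngen_colevel_eq hV]
  simp only [coeff_add, coeff_sub, coeff_prod4_eq_zero _ _ _ _ hm, sub_zero, add_zero]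

/-- **CTC at the co-level for member-complemented up-sets**: `Ñ_{|V|−1}(coFam 𝒳, coFam 𝒵) ∈ ℕ[r]` for all up-sets `𝒳, 𝒵`. [this work] -/
theorem coeff_Ngen_colevel_coFam_nonneg (hV : 0 < Fintype.card α) {F G : Finset (Finset α)} (hF : IsUpperSet (F : Set (Finset α)))
    (hG : IsUpperSet (G : Set (Finset α))) : ∀ m, 0 ≤ (Ngen (Fintype.card α - 1) (coFam F) (coFam G)).coeff m := by
  intro m
  by_cases hm : ∀ i, m i ≤ 4
  · rw [← rev4_rev4 hm, coeff_Ngen_colevel_rev4 hV F G (rev4_le_four m)]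
    exact coeff_M1_nonneg hF hG _
  · rw [coeff_Ngen_colevel_eq_zero hV F G hm]

/-! ### Row (a) at the co-level: `Θ_{|V|−2}·D_{|V|−1} ≤ Π·e_{|V|−1}` -/

/-- **Row (a) at level `|V| − 1`, coefficientwise**: `(Π + D_{|V|−1})·e_{|V|−1} − Θ_{|V|−1}·D_{|V|−1} ∈ ℕ[r]`.  At a profile `1_R + 1_V`
(`R ≠ V`) the single pair `(R, V)` of `Π·D` is paid by the pair `(R ∪ {x}, V ∖ {x})` of `Π·e` (`x ∉ R`); at `2·1_V` by `(V,V)` of `D²`. [this work] -/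
theorem coeff_aPoly_colevel_one_nonneg (hV : 0 < Fintype.card α) (n : α →₀ ℕ) :
    0 ≤ ((PiP + DdC (Fintype.card α - 1)) * ee (Fintype.card α - 1) - ThC (Fintype.card α - 1) * DdC (Fintype.card α - 1) :
      MvPolynomial α ℤ).coeff n := by
  have hTh : (ThC (Fintype.card α - 1) : MvPolynomial α ℤ) = PiP - DdC (Fintype.card α - 1) := by
    rw [PiP_eq_ThC_add_DdC_gen (α := α) (Fintype.card α - 1)]; ring
  have hid : ((PiP + DdC (Fintype.card α - 1)) * ee (Fintype.card α - 1) - ThC (Fintype.card α - 1) * DdC (Fintype.card α - 1) :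
      MvPolynomial α ℤ) = (PiP * ee (Fintype.card α - 1) + DdC (Fintype.card α - 1) * DdC (Fintype.card α - 1)
        - PiP * DdC (Fintype.card α - 1)) + DdC (Fintype.card α - 1) * ee (Fintype.card α - 1) := by
    rw [hTh]; ring
  rw [hid, coeff_add]
  obtain ⟨hPi, hec, -, hDd⟩ := coeff_PiP_ee_nonneg (α := α) (Fintype.card α - 1)
  refine add_nonneg ?_ (cw_mul hDd hec n)
  rw [coeff_sub, coeff_add, sub_nonneg]
  -- the single pair of `Π·D` at this profile, if any
  have hD : (DdC (Fintype.card α - 1) : MvPolynomial α ℤ) = gf {univ} := by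
    unfold DdC bySize; congr 1; ext S
    simp only [mem_filter, mem_powerset, subset_univ, true_and, mem_singleton]
    constructor
    · intro h; exact (card_eq_iff_eq_univ S).1 (by have := card_le_univ S; omega)
    · intro hS; rw [hS, card_univ]; omega
  unfold PiP ee bySize
  rw [hD, coeff_gf_mul_gf, coeff_gf_mul_gf, coeff_gf_mul_gf]
  by_cases h : ∃ R : Finset α, ind R + ind (univ : Finset α) = n
  swap
  · have : ((univ.powerset ×ˢ ({univ} : Finset (Finset α))).filter fun PS => ind PS.1 + ind PS.2 = n) = ∅ := by
      refine filter_eq_empty_iff.2 fun PS hPS hsum => h ⟨PS.1, ?_⟩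
      rw [(mem_singleton.1 (mem_product.1 hPS).2)] at hsum; exact hsum
    rw [this, card_empty]; push_cast; positivity
  obtain ⟨R, hR⟩ := h
  -- the left count is at most one
  have hle : #((univ.powerset ×ˢ ({univ} : Finset (Finset α))).filter fun PS => ind PS.1 + ind PS.2 = n) ≤ 1 := by
    rw [card_le_one]
    intro a ha b hb
    obtain ⟨hma, hsa⟩ := mem_filter.1 ha
    obtain ⟨hmb, hsb⟩ := mem_filter.1 hb
    have ha2 := mem_singleton.1 (mem_product.1 hma).2
    have hb2 := mem_singleton.1 (mem_product.1 hmb).2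
    rw [ha2] at hsa; rw [hb2] at hsb
    have : ind a.1 = ind b.1 := add_right_cancel (hsa.trans hsb.symm)
    exact Prod.ext (ind_injective this) (ha2.trans hb2.symm)
  -- and the right count is at least one
  have hge : 1 ≤ #((univ.powerset ×ˢ univ.powerset.filter fun S : Finset α => #S = Fintype.card α - 1).filter
        fun PS => ind PS.1 + ind PS.2 = n) + #((({univ} : Finset (Finset α)) ×ˢ ({univ} : Finset (Finset α))).filter
        fun PS => ind PS.1 + ind PS.2 = n) := by
    by_cases hRu : R = univ
    · refine le_add_left (card_pos.2 ⟨(univ, univ), mem_filter.2 ⟨mem_product.2 ⟨mem_singleton_self _, mem_singleton_self _⟩, ?_⟩⟩)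
      rw [← hR, hRu]
    · obtain ⟨x, hx⟩ : ((univ : Finset α) \ R).Nonempty := by
        rw [nonempty_iff_ne_empty, ne_eq, sdiff_eq_empty_iff_subset]; exact fun h => hRu (univ_subset_iff.1 h)
      have hxR : x ∉ R := (mem_sdiff.1 hx).2
      refine le_add_right (card_pos.2 ⟨(insert x R, univ.erase x), mem_filter.2 ⟨mem_product.2 ⟨mem_powerset.2 (subset_univ _),
        mem_filter.2 ⟨mem_powerset.2 (subset_univ _), ?_⟩⟩, ?_⟩⟩)
      · rw [card_erase_of_mem (mem_univ x), card_univ]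
      · rw [← hR]
        ext i
        simp only [Finsupp.add_apply, ind_apply, mem_insert, mem_erase, mem_univ, ne_eq, and_true]
        by_cases hix : i = x
        · subst hix; simp [hxR]
        · simp [hix]
  calc (#((univ.powerset ×ˢ ({univ} : Finset (Finset α))).filter fun PS => ind PS.1 + ind PS.2 = n) : ℤ) ≤ 1 := by exact_mod_cast hle
    _ ≤ _ := by exact_mod_cast hge

end Summit.CriticalPhenomena.PercolationContinuityZ3.Theorems.SahiCTCForms
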